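import Literature.AnabelianGeometry.SemiGraphs.PSCNodalCharacterizationIrreducibleNodal
import Literature.AnabelianGeometry.SemiGraphs.PSCIrreducibleMultiNodalOrigin
import HarnessLib

/-!
# [IUTchI] Rmk. 1.2.3 (iv)/(v) at genuine IRREDUCIBLE `k`-NODAL data: the first instance with SEVERAL node groups

Mochizuki, *Inter-universal Teichmüller theory I* [IUTchI] Rmk. 1.2.3 (iv), (v) (kurims pp. 41–43)
[cite: Mochizuki2012, IUTchI Rmk 1.2.3(iv)-(v) pp.41-43]; abc-iut FACT-LIST rows F-1937
(`PSCDatum.NodalEdgeLikeCharacterizationHolds`) and F-1931 (`CuspidalEdgeLikeCharacterizationHolds`).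
PROOF-ONLY file (abc-iut-w5-d160, D-0079 L-F row F-1937; no definitions).  Sequel to
`PSCNodalCharacterizationTwoComponent.lean` (stratum `Δ_h`) and `PSCNodalCharacterizationIrreducibleNodal.lean`
(stratum `Δ_irr`, one loop): abc-iut-f-164's DATA OF IRREDUCIBLE `k`-NODAL SHAPE
(`PSCIrreducibleMultiNodalShape.lean` / `…Origin.lean`: one vertex with `k ≤ g` loops, `Π` a pro-`Σ`
completion `ι : Γ_{g,r} → Π` of the smoothing, `(g, r)` hyperbolic, node groups `Π_{ν_m} = cl ι⟨b_m⟩`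
(`m < k`), cusp groups `cl ι⟨c_j⟩`).

This is the FIRST shape at which the reduction of `PSCEdgeLikeCharacterizationReduction.lean` is exercised
with SEVERAL, pairwise non-conjugate, node groups: hypothesis (I) "`γ•Π_ν ≤ δ•Π_{ν'} ⇒ ν = ν'`" is no longer
trivial and is supplied by abc-iut-f-164's [CombGC] Prop. 1.2 (i) edge clause at this shape
(`edgeLikeOpenInterDeterminesEdge_of_irreducibleMultiNodal`: node/node pairs separated by the handle characters
`b_m ↦ 1`); (E) is `infinite_topologicalClosure_map_zpowers_b` (handle loops have infinite order) and
`infinite_cuspInertia_closure`.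

* `nodalEdgeLikeCharacterization_of_irreducibleMultiNodal` — row F-1937's datum-level statement at every
  datum of irreducible `k`-nodal shape (NON-VACUOUS when `r = 0`: `k` nodes, no cusps);
* `cuspidalEdgeLikeCharacterization_of_irreducibleMultiNodal` — row F-1930 there by the Prop. 1.2 (i) route;
* `nodalEdgeLikeCharacterizationHolds_of_irreducibleMultiNodal` — **F-1937 at every origin of irreducible
  `k`-nodal data** (f-164's shape hypothesis VERBATIM; joins F-0459 / F-1931 / F-0458 of
  `PSCIrreducibleMultiNodalOrigin.lean` there);
* `exists_irreducibleMultiNodalOrigin_rmk123v_holds` — that origin, INHABITED for every nonempty `Σ`, all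
  hyperbolic `(g, r)` and `k ≤ g` (f-164's `exists_irreducibleMultiNodalDatum`) — in particular by the
  NONCUSPIDAL irreducible `k`-nodal curves (`r = 0`, `g ≥ 2`, `1 ≤ k ≤ g`), where the `IsNoncuspidal` guard of
  F-1937 is met with `k` distinct nodes — satisfies `NodalEdgeLikeCharacterizationHolds` ∧
  `OpenInterDeterminesComponentHolds`.

Instance forms at data of the shape of genuine curves (the specialisation isomorphism is a hypothesis on
the shape); consistency evidence for the typed rows, not the printed theorems for all pointed stable curves.
Nothing here takes a side on [IUTchIII] Cor. 3.12. [cite: MochizukiCombGC2007, Prop 1.2(i) p.8]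
-/

noncomputable section

namespace Literature.AnabelianGeometry.SemiGraphs

namespace PSCDatum

open scoped Pointwise
open Literature.GroupTheory.CombinatorialGroupTheory
open Literature.AnabelianGeometry.AbsoluteAnabelian (IsTopologicallyFinitelyGenerated)
open SemiGraphOfAnabelioids (IsProSigmaCompletion infinite_cuspInertia_closure)

universe u

section Shape

variable {P : Type u} [Group P] [TopologicalSpace P] [IsTopologicalGroup P] [CompactSpace P]
  [T2Space P] [TotallyDisconnectedSpace P] {Sigma : Set ℕ} {g r : ℕ}

/-- **[IUTchI] Rmk. 1.2.3 (v) as typed (`NodalEdgeLikeCharacterization`) HOLDS at every datum of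
irreducible `k`-nodal shape** (`Π` profinite, `ι : Γ_{g,r} → Π` a pro-`Σ` completion, `(g, r)` hyperbolic,
nodes `≃ Fin k`, `k ≤ g`, with groups `cl ι⟨b_m⟩`, cusps `≃ Fin r` with the closed cusp inertia groups):
(I) is f-164's `edgeLikeOpenInterDeterminesEdge_of_irreducibleMultiNodal`, (E) is
`infinite_topologicalClosure_map_zpowers_b`. [cite: Mochizuki2012, IUTchI Rmk 1.2.3(v) p.43] -/
theorem nodalEdgeLikeCharacterization_of_irreducibleMultiNodal (G : PSCDatum P) (hne : Sigma.Nonempty)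
    (hprime : ∀ p ∈ Sigma, p.Prime) (ι : PuncturedSurfaceGroup g r →* P)
    (hι : IsProSigmaCompletion Sigma ι) {k : ℕ} (hk : k ≤ g)
    (hhyp : PuncturedSurfaceGroup.IsHyperbolicType g r) (e : G.graph.C ≃ Fin r)
    (hC : ∀ c, G.cuspGp c =
      ((PuncturedSurfaceGroup.cuspInertia (g := g) (e c)).map ι).topologicalClosure)
    (eN : G.graph.N ≃ Fin k)
    (hE : ∀ m, G.nodeGp m = ((Subgroup.zpowers
      (PuncturedSurfaceGroup.b (r := r) (Fin.castLE hk (eN m)))).map ι).topologicalClosure) :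
    G.NodalEdgeLikeCharacterization := by
  have hne' := hne
  obtain ⟨ℓ, hℓS⟩ := hne
  have hℓ : ℓ.Prime := hprime ℓ hℓS
  refine G.nodalEdgeLikeCharacterization_of_edgeLikeOpenInter
    (IsProSigmaCompletion.isTopologicallyFinitelyGenerated_of_puncturedSurfaceGroup (MulEquiv.refl _) hι)
    (fun m => ?_) (fun m => ?_)
    (G.edgeLikeOpenInterDeterminesEdge_of_irreducibleMultiNodal hne' hprime ι hι hk hhyp e hC eN hE)
  · rw [hE m, MonoidHom.map_zpowers]
    exact ⟨_, rfl⟩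
  · rw [hE m]
    exact infinite_topologicalClosure_map_zpowers_b hι hℓ hℓS _

/-- **[IUTchI] Rmk. 1.2.3 (iv), cuspidal part, as typed (row F-1930) at every datum of irreducible
`k`-nodal shape**, by the Prop. 1.2 (i) route ((I) from f-164's edge clause, (E) from
`infinite_cuspInertia_closure`). [cite: Mochizuki2012, IUTchI Rmk 1.2.3(iv) pp.41-42] -/
theorem cuspidalEdgeLikeCharacterization_of_irreducibleMultiNodal (G : PSCDatum P)
    (hne : Sigma.Nonempty) (hprime : ∀ p ∈ Sigma, p.Prime) (ι : PuncturedSurfaceGroup g r →* P)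
    (hι : IsProSigmaCompletion Sigma ι) {k : ℕ} (hk : k ≤ g)
    (hhyp : PuncturedSurfaceGroup.IsHyperbolicType g r) (e : G.graph.C ≃ Fin r)
    (hC : ∀ c, G.cuspGp c =
      ((PuncturedSurfaceGroup.cuspInertia (g := g) (e c)).map ι).topologicalClosure)
    (eN : G.graph.N ≃ Fin k)
    (hE : ∀ m, G.nodeGp m = ((Subgroup.zpowers
      (PuncturedSurfaceGroup.b (r := r) (Fin.castLE hk (eN m)))).map ι).topologicalClosure) :
    G.CuspidalEdgeLikeCharacterization := by
  have hne' := hne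
  refine G.cuspidalEdgeLikeCharacterization_of_edgeLikeOpenInter
    (IsProSigmaCompletion.isTopologicallyFinitelyGenerated_of_puncturedSurfaceGroup (MulEquiv.refl _) hι)
    (fun c => ?_) (fun c => ?_)
    (G.edgeLikeOpenInterDeterminesEdge_of_irreducibleMultiNodal hne' hprime ι hι hk hhyp e hC eN hE)
  · rw [hC c, PuncturedSurfaceGroup.cuspInertia, MonoidHom.map_zpowers]
    exact ⟨_, rfl⟩
  · rw [hC c]
    exact Set.infinite_coe_iff.mp (infinite_cuspInertia_closure hne hprime hhyp ι hι (e c))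

end Shape

/-! ### Origin level (f-164's shape verbatim) -/

section Origin

variable (Ω : PSCOrigin.{u})

/-- **Row F-1937 (`NodalEdgeLikeCharacterizationHolds Ω`) HOLDS at every origin whose data are of
irreducible `k`-nodal shape** — abc-iut-f-164's shape hypothesis of
`openInterDeterminesComponentHolds_of_irreducibleMultiNodal` VERBATIM.
[cite: Mochizuki2012, IUTchI Rmk 1.2.3(v) p.43] -/
theorem nodalEdgeLikeCharacterizationHolds_of_irreducibleMultiNodal
    (hΩ : ∀ ⦃Q : Type u⦄ [Group Q] [TopologicalSpace Q] [IsTopologicalGroup Q] (G : PSCDatum Q),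
      Ω.IsOfPSCType G → CompactSpace Q ∧ T2Space Q ∧ TotallyDisconnectedSpace Q ∧
        ∃ (S : Set ℕ) (g r k : ℕ) (hk : k ≤ g) (ι : PuncturedSurfaceGroup g r →* Q)
          (e : G.graph.C ≃ Fin r) (v₀ : G.graph.V) (eN : G.graph.N ≃ Fin k),
          S.Nonempty ∧ (∀ p ∈ S, p.Prime) ∧ IsProSigmaCompletion S ι ∧
          PuncturedSurfaceGroup.IsHyperbolicType g r ∧
          (∀ c, G.cuspGp c =
            ((PuncturedSurfaceGroup.cuspInertia (g := g) (e c)).map ι).topologicalClosure) ∧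
          (∀ w, w = v₀) ∧
          (∀ m, G.nodeGp m = ((Subgroup.zpowers
            (PuncturedSurfaceGroup.b (r := r) (Fin.castLE hk (eN m)))).map ι).topologicalClosure)) :
    NodalEdgeLikeCharacterizationHolds Ω := by
  intro Q _ _ _ G hG
  obtain ⟨hc, ht, hd, S, g, r, k, hk, ι, e, v₀, eN, hne, hprime, hι, hhyp, hC, -, hE⟩ := hΩ G hG
  haveI := hc
  haveI := ht
  haveI := hd
  exact G.nodalEdgeLikeCharacterization_of_irreducibleMultiNodal hne hprime ι hι hk hhyp e hC eN hE

/-- **An origin of irreducible `k`-nodal data at which F-1937 (`NodalEdgeLikeCharacterizationHolds`) and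
F-0459 (`OpenInterDeterminesComponentHolds`) HOLD, INHABITED by abc-iut-f-164's genuine data** for every
nonempty set of primes `Σ`, all hyperbolic `(g, r)` and every `k ≤ g` (`exists_irreducibleMultiNodalDatum`):
one vertex, `k` nodes, `r` cusps — in particular the NONCUSPIDAL irreducible `k`-nodal curves (`r = 0`,
`g ≥ 2`), at which the `IsNoncuspidal` guard of F-1937 is met with `k` pairwise non-conjugate node groups.
[cite: Mochizuki2012, IUTchI Rmk 1.2.3(v) p.43] [cite: MochizukiCombGC2007, Prop 1.2(i) p.8] -/
theorem exists_irreducibleMultiNodalOrigin_rmk123v_holds :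
    ∃ Ω : PSCOrigin.{0},
      (∀ (S : Set ℕ), S.Nonempty → (∀ p ∈ S, p.Prime) → ∀ g r k : ℕ,
        PuncturedSurfaceGroup.IsHyperbolicType g r → k ≤ g →
        ∃ (Q : ProfiniteGrp.{0}) (ι : PuncturedSurfaceGroup g r →* Q) (G : PSCDatum Q),
          IsProSigmaCompletion S ι ∧ Ω.IsOfPSCType G ∧ G.Sigma = S ∧ G.graph.i = 1 ∧ G.graph.n = k ∧
          G.graph.r = r ∧ (r = 0 → G.graph.IsNoncuspidal) ∧ ∀ m : G.graph.N, G.IsNodal (G.nodeGp m)) ∧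
      NodalEdgeLikeCharacterizationHolds Ω ∧ OpenInterDeterminesComponentHolds Ω := by
  classical
  -- the origin: f-164's irreducible `k`-nodal shape, profinite carriers
  let Ω : PSCOrigin.{0} :=
    ⟨fun {Q} _ _ G => ∃ (_ : IsTopologicalGroup Q),
      CompactSpace Q ∧ T2Space Q ∧ TotallyDisconnectedSpace Q ∧
        ∃ (S : Set ℕ) (g r k : ℕ) (hk : k ≤ g) (ι : PuncturedSurfaceGroup g r →* Q)
          (e : G.graph.C ≃ Fin r) (v₀ : G.graph.V) (eN : G.graph.N ≃ Fin k),
          S.Nonempty ∧ (∀ p ∈ S, p.Prime) ∧ IsProSigmaCompletion S ι ∧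
          PuncturedSurfaceGroup.IsHyperbolicType g r ∧
          (∀ c, G.cuspGp c =
            ((PuncturedSurfaceGroup.cuspInertia (g := g) (e c)).map ι).topologicalClosure) ∧
          (∀ w, w = v₀) ∧
          (∀ m, G.nodeGp m = ((Subgroup.zpowers
            (PuncturedSurfaceGroup.b (r := r) (Fin.castLE hk (eN m)))).map ι).topologicalClosure)⟩
  have hΩ : ∀ ⦃Q : Type⦄ [Group Q] [TopologicalSpace Q] [IsTopologicalGroup Q] (G : PSCDatum Q),
      Ω.IsOfPSCType G → CompactSpace Q ∧ T2Space Q ∧ TotallyDisconnectedSpace Q ∧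
        ∃ (S : Set ℕ) (g r k : ℕ) (hk : k ≤ g) (ι : PuncturedSurfaceGroup g r →* Q)
          (e : G.graph.C ≃ Fin r) (v₀ : G.graph.V) (eN : G.graph.N ≃ Fin k),
          S.Nonempty ∧ (∀ p ∈ S, p.Prime) ∧ IsProSigmaCompletion S ι ∧
          PuncturedSurfaceGroup.IsHyperbolicType g r ∧
          (∀ c, G.cuspGp c =
            ((PuncturedSurfaceGroup.cuspInertia (g := g) (e c)).map ι).topologicalClosure) ∧
          (∀ w, w = v₀) ∧
          (∀ m, G.nodeGp m = ((Subgroup.zpowers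
            (PuncturedSurfaceGroup.b (r := r) (Fin.castLE hk (eN m)))).map ι).topologicalClosure) :=
    fun Q _ _ _ G hG => hG.2
  refine ⟨Ω, fun S hne hprime g r k hhyp hk => ?_,
    nodalEdgeLikeCharacterizationHolds_of_irreducibleMultiNodal Ω hΩ,
    openInterDeterminesComponentHolds_of_irreducibleMultiNodal Ω hΩ⟩
  -- inhabited by f-164's genuine irreducible `k`-nodal datum
  obtain ⟨Q, ι, G, e, v₀, eN, hι, hS, hi, hn, hr, hC, hV, hE, -, -, -⟩ :=
    exists_irreducibleMultiNodalDatum S hne hprime g r k hk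
  exact ⟨Q, ι, G, hι, ⟨inferInstance, inferInstance, inferInstance, inferInstance, S, g, r, k, hk, ι, e, v₀,
    eN, hne, hprime, hι, hhyp, hC, hV, hE⟩, hS, hi, hn, hr, fun hr0 => show G.graph.r = 0 from hr.trans hr0,
    fun m => ⟨m, 1, (one_smul _ _).symm⟩⟩

end Origin

end PSCDatum

end Literature.AnabelianGeometry.SemiGraphs

end
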